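import Literature.Geometry.Riemannian.MetricFlowPhiLipschitz
import Mathlib.MeasureTheory.Function.ContinuousMapDense
import Mathlib.Topology.MetricSpace.ThickenedIndicator
import HarnessLib

/-!
# Lipschitz functions are dense in `L¹`; `L¹`-approximation by `Φ ∘ (Lipschitz)` functions
# (Bamler 2023, §2.3, Lemma 2.4 (b); the limit argument for §3.1, Lemma 3.3)

R. Bamler, *Compactness theory of the space of super Ricci flows*, Invent. Math. 233 (2023), §2.3,
Lemma 2.4 (b) (arXiv v1 Lemma 4 (b)): for a complete separable metric space `X` and `μ ∈ 𝒫(X)`,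
"The set of bounded Lipschitz functions `X → ℝ` is dense in `L^p(X, μ)` for all `p < ∞`"; proof:
"`χ_A` can be approximated by Lipschitz functions in `L^p(X, μ)`. Since characteristic functions
span a dense subspace in `L^p(X, μ)`, this shows Assertion (b)." It is invoked before Lemma 3.3
(arXiv v1 Lemma 29): "Due to Lemma 2.4 (b) the case `T = 0` in Definition 3.2 (6) follows from
`T > 0` by a limit argument" — i.e. a measurable `u : X → [0, 1]` is an `L¹`-limit of functions
`Φ ∘ fₙ` with `fₙ` Lipschitz (`Φ` = `MetricFlow.Phi`, `Φ⁻¹` = `MetricFlow.PhiInv`).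

This file (helpers for `MetricFlowGradientPropertyZeroOfPos.lean`) proves, for a FINITE Borel
measure `ρ` on a metric space `X` (completeness and separability are not needed):

* `exists_lipschitzWith_eLpNorm_sub_indicator_le`, `exists_lipschitzWith_eLpNorm_sub_le` —
  Lemma 2.4 (b) for `p = 1`: every `u ∈ L¹(ρ)` is within `ε` in `L¹` of a Lipschitz function
  (Mathlib's `MemLp.induction_dense`; inner regularity of `ρ` by closed sets; closed sets via the
  Lipschitz thickened indicators `thickenedIndicator`, dominated convergence);
* `MetricFlow.lipschitzOnWith_PhiInv_Icc` — `Φ⁻¹` is `√(4π) e^{M²/4}`-Lipschitz on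
  `[Φ(−M), Φ(M)]` (`(Φ⁻¹)'(Φ x) = 1/Φ'(x) = √(4π) e^{x²/4}`, (3.1));
* `MetricFlow.exists_seq_lipschitzWith_tendsto_lintegral_Phi_sub` — for a measurable
  `u : X → [0, 1]` there are Lipschitz `fₙ : X → ℝ` with `∫ |Φ ∘ fₙ − u| dρ → 0`: take Lipschitz
  `gₙ` with `‖u − gₙ‖_{L¹(ρ)} ≤ 1/n`, clamp to `[0, 1]`, squeeze affinely into `[Φ(−n), Φ(n)]`
  (error `≤ Φ(−n) + 1 − Φ(n) → 0`) and apply `Φ⁻¹`, Lipschitz there;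
* `tendsto_integral_of_tendsto_lintegral_enorm_sub` — `∫ Fₙ dμ → ∫ u dμ` when
  `∫ |Fₙ − u| dρ → 0` for some `ρ ≥ μ`.

Everything is proved; no definitions, no named facts.

## References

* R. H. Bamler, *Compactness theory of the space of super Ricci flows*, Invent. Math. 233 (2023),
  1121–1277 (arXiv:2008.09298), §2.3, Lemma 2.4 (b); §3, (3.1); §3.1, Lemma 3.3
  (arXiv v1 Lemma 29). [Bamler2023]
-/

noncomputable section

open Set MeasureTheory Filter TopologicalSpace Function
open scoped Topology ENNReal NNReal

namespace Literature.Geometry.Riemannian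

universe u

/-! ### Lipschitz functions are dense in `L¹` (Bamler 2023, Lemma 2.4 (b)) -/

section Density

variable {X : Type*} [MetricSpace X] [MeasurableSpace X] [BorelSpace X]

/-- The indicator of a closed set times a constant is `L¹`-approximated, for a finite Borel measure
on a metric space, by Lipschitz functions: the thickened indicators `χ^δ_F · c`, `δ = 1/(n+1)`,
converge to `χ_F · c` pointwise and boundedly (Bamler 2023, proof of Lemma 2.4 (b): "`χ_A` can be
approximated by Lipschitz functions in `L^p(X, μ)`"). [folklore] -/
theorem exists_lipschitzWith_eLpNorm_sub_indicator_le {ρ : Measure X} [IsFiniteMeasure ρ]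
    {s : Set X} (hs : IsClosed s) (c : ℝ) {ε : ℝ≥0∞} (hε : ε ≠ 0) :
    ∃ g : X → ℝ, eLpNorm (g - s.indicator fun _ ↦ c) 1 ρ ≤ ε ∧ ∃ K, LipschitzWith K g := by
  have hδpos : ∀ n : ℕ, (0 : ℝ) < 1 / ((n : ℝ) + 1) := fun n ↦ Nat.one_div_pos_of_nat
  have hδlim : Tendsto (fun n : ℕ ↦ (1 : ℝ) / ((n : ℝ) + 1)) atTop (𝓝 0) :=
    tendsto_one_div_add_atTop_nhds_zero_nat
  set θ : ℕ → X → ℝ := fun n x ↦ ((thickenedIndicator (hδpos n) s x : ℝ≥0) : ℝ) with hθ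
  have hθc : ∀ n, Continuous (θ n) := fun n ↦
    NNReal.continuous_coe.comp (thickenedIndicator (hδpos n) s).continuous
  have hθ01 : ∀ n x, θ n x ∈ Icc (0 : ℝ) 1 := fun n x ↦
    ⟨NNReal.coe_nonneg _, by
      show ((thickenedIndicator (hδpos n) s x : ℝ≥0) : ℝ) ≤ 1
      exact_mod_cast thickenedIndicator_le_one (hδpos n) s x⟩
  -- pointwise convergence of the thickened indicators to the indicator of the closed set `s`
  have hpt : ∀ x, Tendsto (fun n ↦ θ n x) atTop (𝓝 (s.indicator (fun _ ↦ (1 : ℝ)) x)) := by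
    intro x
    have h := thickenedIndicator_tendsto_indicator_closure hδpos hδlim s
    rw [tendsto_pi_nhds, hs.closure_eq] at h
    have h' := (NNReal.continuous_coe.tendsto _).comp (h x)
    simp only [NNReal.coe_indicator, NNReal.coe_one] at h'
    exact h'
  -- dominated convergence: the `L¹` error tends to `0`
  have hlim : Tendsto (fun n ↦ ∫⁻ x, ‖c * θ n x - s.indicator (fun _ ↦ c) x‖ₑ ∂ρ) atTop (𝓝 0) := by
    have h := tendsto_lintegral_of_dominated_convergence (μ := ρ)
      (F := fun n x ↦ ‖c * θ n x - s.indicator (fun _ ↦ c) x‖ₑ) (f := fun _ ↦ 0)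
      (fun _ ↦ ENNReal.ofReal (2 * |c|)) (fun n ↦ ?_) (fun n ↦ ae_of_all _ fun x ↦ ?_) ?_ ?_
    · simpa only [lintegral_zero] using h
    · exact (((hθc n).measurable.const_mul c).sub
        (measurable_const.indicator hs.measurableSet)).enorm
    · dsimp only
      rw [Real.enorm_eq_ofReal_abs]
      refine ENNReal.ofReal_le_ofReal ?_
      have h1 : |c * θ n x| ≤ |c| := by
        rw [abs_mul, abs_of_nonneg (hθ01 n x).1]
        exact mul_le_of_le_one_right (abs_nonneg _) (hθ01 n x).2
      have h2 : |s.indicator (fun _ ↦ c) x| ≤ |c| := by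
        by_cases hx : x ∈ s <;> simp [hx]
      calc |c * θ n x - s.indicator (fun _ ↦ c) x|
          ≤ |c * θ n x| + |s.indicator (fun _ ↦ c) x| := abs_sub _ _
        _ ≤ 2 * |c| := by linarith
    · rw [lintegral_const]
      exact ENNReal.mul_ne_top ENNReal.ofReal_ne_top (measure_ne_top ρ _)
    · refine ae_of_all _ fun x ↦ ?_
      have h1 : Tendsto (fun n ↦ c * θ n x - s.indicator (fun _ ↦ c) x) atTop
          (𝓝 (c * s.indicator (fun _ ↦ (1 : ℝ)) x - s.indicator (fun _ ↦ c) x)) :=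
        ((hpt x).const_mul c).sub_const _
      have h0 : c * s.indicator (fun _ ↦ (1 : ℝ)) x - s.indicator (fun _ ↦ c) x = 0 := by
        by_cases hx : x ∈ s <;> simp [hx]
      rw [h0] at h1
      simpa only [enorm_zero] using h1.enorm
  obtain ⟨n, hn⟩ := (hlim.eventually (ge_mem_nhds (pos_iff_ne_zero.2 hε))).exists
  refine ⟨fun x ↦ c * θ n x, ?_, _,
    (lipschitzWith_smul c).comp
      (NNReal.isometry_coe.lipschitz.comp (lipschitzWith_thickenedIndicator (hδpos n) s))⟩
  rw [eLpNorm_one_eq_lintegral_enorm]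
  exact hn

/-- **Lipschitz functions are dense in `L¹(X, ρ)`** for a finite Borel measure `ρ` on a metric
space `X` (Bamler 2023, Lemma 2.4 (b), `p = 1`): every `u ∈ L¹(ρ)` is within `ε` in `L¹` of a
Lipschitz function. Proof: simple functions are dense (`MemLp.induction_dense`), a measurable set
of finite measure is inner-approximated by closed sets (weak regularity of finite Borel measures on
metric spaces), and closed sets are handled by `exists_lipschitzWith_eLpNorm_sub_indicator_le`.
[folklore] -/
theorem exists_lipschitzWith_eLpNorm_sub_le {ρ : Measure X} [IsFiniteMeasure ρ] {u : X → ℝ}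
    (hu : MemLp u 1 ρ) {ε : ℝ≥0∞} (hε : ε ≠ 0) :
    ∃ g : X → ℝ, eLpNorm (u - g) 1 ρ ≤ ε ∧ ∃ K, LipschitzWith K g := by
  refine hu.induction_dense ENNReal.one_ne_top (fun g : X → ℝ ↦ ∃ K, LipschitzWith K g)
    ?_ ?_ ?_ hε
  · intro c t ht htρ ε hε
    obtain ⟨η, hηpos, hη⟩ := exists_Lp_half ℝ ρ 1 hε
    obtain ⟨η', hη'pos, hη'⟩ := exists_eLpNorm_indicator_le (μ := ρ) ENNReal.one_ne_top c hηpos.ne'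
    obtain ⟨s, hst, hs, hρs⟩ := ht.exists_isClosed_sdiff_lt htρ.ne (ENNReal.coe_pos.2 hη'pos).ne'
    obtain ⟨g, hg, K, hK⟩ := exists_lipschitzWith_eLpNorm_sub_indicator_le (ρ := ρ) hs c hηpos.ne'
    have I1 : eLpNorm ((s.indicator fun _ ↦ c) - t.indicator fun _ ↦ c) 1 ρ ≤ η := by
      rw [← eLpNorm_neg, neg_sub, ← indicator_sdiff hst]
      exact hη' _ hρs.le
    refine ⟨g, ?_, K, hK⟩
    have h := hη _ _
      (hK.continuous.aestronglyMeasurable.sub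
        (aestronglyMeasurable_const.indicator hs.measurableSet))
      ((aestronglyMeasurable_const.indicator hs.measurableSet).sub
        (aestronglyMeasurable_const.indicator ht)) hg I1
    rw [sub_add_sub_cancel] at h
    exact h.le
  · rintro f g ⟨Kf, hf⟩ ⟨Kg, hg⟩
    exact ⟨Kf + Kg, hf.add hg⟩
  · rintro f ⟨K, hf⟩
    exact hf.continuous.aestronglyMeasurable

end Density

/-- If `∫ |Fₙ − u| dρ → 0` for a measure `ρ ≥ μ`, then `∫ Fₙ dμ → ∫ u dμ`. [folklore] -/
theorem tendsto_integral_of_tendsto_lintegral_enorm_sub {X : Type*} [MeasurableSpace X]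
    {μ ρ : Measure X} (hμρ : μ ≤ ρ) {F : ℕ → X → ℝ} {u : X → ℝ} (hF : ∀ n, Integrable (F n) μ)
    (hu : AEStronglyMeasurable u μ)
    (h : Tendsto (fun n ↦ ∫⁻ x, ‖F n x - u x‖ₑ ∂ρ) atTop (𝓝 0)) :
    Tendsto (fun n ↦ ∫ x, F n x ∂μ) atTop (𝓝 (∫ x, u x ∂μ)) :=
  tendsto_integral_of_L1 u hu (Eventually.of_forall hF)
    (tendsto_of_tendsto_of_tendsto_of_le_of_le tendsto_const_nhds h (fun _ ↦ zero_le)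
      fun _ ↦ lintegral_mono' hμρ le_rfl)

namespace MetricFlow

/-! ### `Φ⁻¹` is Lipschitz on compact subintervals of `(0, 1)`; clamped approximants -/

/-- **`Φ⁻¹` is Lipschitz on `[Φ(−M), Φ(M)]`** with constant `√(4π) e^{M²/4}`: there
`(Φ⁻¹)'(Φ x) = 1/Φ'(x) = √(4π) e^{x²/4}` with `|x| ≤ M` (Bamler 2023, (3.1); mean value
inequality). [cite: Bamler2023, §3.1, Lemma 3.3 (arXiv v1 Lemma 29)] -/
theorem lipschitzOnWith_PhiInv_Icc (M : ℝ) :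
    LipschitzOnWith (Real.toNNReal (Real.sqrt (4 * Real.pi) * Real.exp (M ^ 2 / 4))) PhiInv
      (Icc (Phi (-M)) (Phi M)) := by
  refine (convex_Icc _ _).lipschitzOnWith_of_nnnorm_deriv_le (𝕜 := ℝ) (fun c hc ↦ ?_)
    fun c hc ↦ ?_
  · obtain ⟨x, rfl⟩ := exists_Phi_eq ((Phi_pos _).trans_le hc.1) (hc.2.trans_lt (Phi_lt_one _))
    exact (hasDerivAt_PhiInv x).differentiableAt
  · obtain ⟨x, rfl⟩ := exists_Phi_eq ((Phi_pos _).trans_le hc.1) (hc.2.trans_lt (Phi_lt_one _))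
    have hx1 : -M ≤ x := Phi_strictMono.le_iff_le.1 hc.1
    have hx2 : x ≤ M := Phi_strictMono.le_iff_le.1 hc.2
    rw [(hasDerivAt_PhiInv x).deriv, mul_inv, inv_inv, ← Real.exp_neg, ← NNReal.coe_le_coe,
      coe_nnnorm, Real.norm_of_nonneg (by positivity), Real.coe_toNNReal _ (by positivity)]
    gcongr
    linarith [sq_le_sq' hx1 hx2]

/-- The clamped affine map `t ↦ Φ(−M) + (Φ(M) − Φ(−M)) · max 0 (min 1 t)` takes values in
`[Φ(−M), Φ(M)]` (`M ≥ 0`). [folklore] -/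
theorem affine_clamp_mem_Icc {M : ℝ} (hM : 0 ≤ M) (t : ℝ) :
    Phi (-M) + (Phi M - Phi (-M)) * max 0 (min 1 t) ∈ Icc (Phi (-M)) (Phi M) := by
  have hc0 : 0 ≤ max 0 (min 1 t) := le_max_left _ _
  have hc1 : max 0 (min 1 t) ≤ 1 := max_le zero_le_one (min_le_left _ _)
  have hd0 : 0 ≤ Phi M - Phi (-M) := sub_nonneg.2 (Phi_mono (by linarith))
  constructor <;> nlinarith

/-- `t ↦ Φ⁻¹(Φ(−M) + (Φ(M) − Φ(−M)) · max 0 (min 1 t))` is Lipschitz (`M ≥ 0`): the clamped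
affine map is `1`-Lipschitz with values in `[Φ(−M), Φ(M)]`, where `Φ⁻¹` is Lipschitz
(`lipschitzOnWith_PhiInv_Icc`). [cite: Bamler2023, §3.1, Lemma 3.3 (arXiv v1 Lemma 29)] -/
theorem exists_lipschitzWith_PhiInv_affine_clamp {M : ℝ} (hM : 0 ≤ M) :
    ∃ K, LipschitzWith K fun t : ℝ ↦ PhiInv (Phi (-M) + (Phi M - Phi (-M)) * max 0 (min 1 t)) := by
  have hd0 : 0 ≤ Phi M - Phi (-M) := sub_nonneg.2 (Phi_mono (by linarith))
  have hd1 : Phi M - Phi (-M) ≤ 1 := by linarith [Phi_pos (-M), Phi_lt_one M]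
  have hin : LipschitzWith 1 fun t : ℝ ↦ Phi (-M) + (Phi M - Phi (-M)) * max 0 (min 1 t) := by
    refine LipschitzWith.of_dist_le_mul fun t t' ↦ ?_
    have h := ((LipschitzWith.id.const_min 1).const_max 0).dist_le_mul t t'
    simp only [NNReal.coe_one, one_mul, id_eq, Real.dist_eq] at h ⊢
    rw [add_sub_add_left_eq_sub, ← mul_sub, abs_mul, abs_of_nonneg hd0]
    exact (mul_le_of_le_one_left (abs_nonneg _) hd1).trans h
  have hmaps : MapsTo (fun t : ℝ ↦ Phi (-M) + (Phi M - Phi (-M)) * max 0 (min 1 t)) univ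
      (Icc (Phi (-M)) (Phi M)) := fun t _ ↦ affine_clamp_mem_Icc hM t
  exact ⟨_, lipschitzOnWith_univ.1 ((lipschitzOnWith_PhiInv_Icc M).comp hin.lipschitzOnWith hmaps)⟩

/-- Pointwise error of the clamped approximant: for `v ∈ [0, 1]`,
`|Φ(−M) + (Φ(M) − Φ(−M)) · max 0 (min 1 t) − v| ≤ (Φ(−M) + 1 − Φ(M)) + |t − v|` (clamping to
`[0, 1]` is `1`-Lipschitz and fixes `v`). [folklore] -/
theorem abs_affine_clamp_sub_le (M t : ℝ) {v : ℝ} (hv : v ∈ Icc (0 : ℝ) 1) :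
    |Phi (-M) + (Phi M - Phi (-M)) * max 0 (min 1 t) - v| ≤ (Phi (-M) + (1 - Phi M)) + |t - v| := by
  have hc0 : 0 ≤ max 0 (min 1 t) := le_max_left _ _
  have hc1 : max 0 (min 1 t) ≤ 1 := max_le zero_le_one (min_le_left _ _)
  have hcv : |max 0 (min 1 t) - v| ≤ |t - v| := by
    have h := ((LipschitzWith.id.const_min 1).const_max 0).dist_le_mul t v
    simp only [NNReal.coe_one, one_mul, id_eq, Real.dist_eq] at h
    rwa [min_eq_right hv.2, max_eq_right hv.1] at h
  have ha : 0 ≤ Phi (-M) := (Phi_pos _).le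
  have hb : Phi M ≤ 1 := (Phi_lt_one _).le
  calc |Phi (-M) + (Phi M - Phi (-M)) * max 0 (min 1 t) - v|
      = |(Phi (-M) * (1 - max 0 (min 1 t)) - (1 - Phi M) * max 0 (min 1 t)) +
          (max 0 (min 1 t) - v)| := by congr 1; ring
    _ ≤ |Phi (-M) * (1 - max 0 (min 1 t)) - (1 - Phi M) * max 0 (min 1 t)| +
          |max 0 (min 1 t) - v| := abs_add_le _ _
    _ ≤ (Phi (-M) + (1 - Phi M)) + |t - v| := by
        refine add_le_add (abs_le.2 ⟨?_, ?_⟩) hcv <;> nlinarith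

/-! ### The approximating sequence `Φ ∘ fₙ → u` in `L¹` -/

variable {X : Type*} [MetricSpace X] [MeasurableSpace X] [BorelSpace X]

/-- **`u` is an `L¹`-limit of functions `Φ ∘ fₙ` with `fₙ` Lipschitz** (the approximation behind
Bamler's "limit argument" for Lemma 3.3): for a finite Borel measure `ρ` on a metric space and a
measurable `u : X → [0, 1]` there are Lipschitz `fₙ : X → ℝ` with `∫ |Φ ∘ fₙ − u| dρ → 0`. Take
Lipschitz `gₙ` with `‖u − gₙ‖_{L¹} ≤ 1/n` (`exists_lipschitzWith_eLpNorm_sub_le`), clamp to `[0, 1]`,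
squeeze into `[Φ(−n), Φ(n)]` and apply `Φ⁻¹`, Lipschitz there.
[cite: Bamler2023, §3.1, Lemma 3.3 (arXiv v1 Lemma 29)] -/
theorem exists_seq_lipschitzWith_tendsto_lintegral_Phi_sub (ρ : Measure X) [IsFiniteMeasure ρ]
    {u : X → ℝ} (hu : Measurable u) (h01 : ∀ x, u x ∈ Icc (0 : ℝ) 1) :
    ∃ f : ℕ → X → ℝ, (∀ n, ∃ K, LipschitzWith K (f n)) ∧
      Tendsto (fun n ↦ ∫⁻ x, ‖Phi (f n x) - u x‖ₑ ∂ρ) atTop (𝓝 0) := by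
  have hmem : MemLp u 1 ρ := memLp_one_iff_integrable.2
    (Integrable.of_mem_Icc 0 1 hu.aemeasurable (ae_of_all _ h01))
  have hε : ∀ n : ℕ, (n : ℝ≥0∞)⁻¹ ≠ 0 := fun n ↦ ENNReal.inv_ne_zero.2 (ENNReal.natCast_ne_top n)
  choose g hg hgK using fun n ↦ exists_lipschitzWith_eLpNorm_sub_le hmem (hε n)
  refine ⟨fun n x ↦ PhiInv (Phi (-(n : ℝ)) + (Phi n - Phi (-(n : ℝ))) * max 0 (min 1 (g n x))),
    fun n ↦ ?_, ?_⟩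
  · obtain ⟨K, hK⟩ := hgK n
    obtain ⟨K', hK'⟩ := exists_lipschitzWith_PhiInv_affine_clamp (Nat.cast_nonneg n : (0 : ℝ) ≤ n)
    exact ⟨K' * K, hK'.comp hK⟩
  · have hval : ∀ (n : ℕ) (x : X),
        Phi (PhiInv (Phi (-(n : ℝ)) + (Phi n - Phi (-(n : ℝ))) * max 0 (min 1 (g n x)))) =
          Phi (-(n : ℝ)) + (Phi n - Phi (-(n : ℝ))) * max 0 (min 1 (g n x)) := by
      intro n x
      have h := affine_clamp_mem_Icc (Nat.cast_nonneg n : (0 : ℝ) ≤ n) (g n x)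
      exact Phi_PhiInv ((Phi_pos _).trans_le h.1) (h.2.trans_lt (Phi_lt_one _))
    have hbound : ∀ n : ℕ,
        ∫⁻ x, ‖Phi (PhiInv (Phi (-(n : ℝ)) + (Phi n - Phi (-(n : ℝ))) * max 0 (min 1 (g n x)))) -
          u x‖ₑ ∂ρ ≤ ENNReal.ofReal (Phi (-(n : ℝ)) + (1 - Phi n)) * ρ univ + (n : ℝ≥0∞)⁻¹ := by
      intro n
      calc _ ≤ ∫⁻ x, ENNReal.ofReal (Phi (-(n : ℝ)) + (1 - Phi n)) + ‖u x - g n x‖ₑ ∂ρ := by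
            refine lintegral_mono fun x ↦ ?_
            rw [hval, Real.enorm_eq_ofReal_abs, Real.enorm_eq_ofReal_abs,
              ← ENNReal.ofReal_add (by linarith [Phi_pos (-(n : ℝ)), Phi_lt_one (n : ℝ)])
                (abs_nonneg _), abs_sub_comm (u x)]
            exact ENNReal.ofReal_le_ofReal (abs_affine_clamp_sub_le _ _ (h01 x))
        _ = ENNReal.ofReal (Phi (-(n : ℝ)) + (1 - Phi n)) * ρ univ + eLpNorm (u - g n) 1 ρ := by
            rw [lintegral_add_left measurable_const, lintegral_const, eLpNorm_one_eq_lintegral_enorm]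
            rfl
        _ ≤ _ := add_le_add le_rfl (hg n)
    refine tendsto_of_tendsto_of_tendsto_of_le_of_le tendsto_const_nhds ?_ (fun _ ↦ zero_le)
      hbound
    have he : Tendsto (fun n : ℕ ↦ Phi (-(n : ℝ)) + (1 - Phi n)) atTop (𝓝 0) := by
      have h1 : Tendsto (fun n : ℕ ↦ Phi (-(n : ℝ))) atTop (𝓝 0) :=
        tendsto_Phi_atBot.comp (tendsto_neg_atTop_atBot.comp tendsto_natCast_atTop_atTop)
      have h2 : Tendsto (fun n : ℕ ↦ 1 - Phi (n : ℝ)) atTop (𝓝 (1 - 1)) :=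
        tendsto_const_nhds.sub (tendsto_Phi_atTop.comp tendsto_natCast_atTop_atTop)
      simpa using h1.add h2
    have h3 : Tendsto (fun n : ℕ ↦ ENNReal.ofReal (Phi (-(n : ℝ)) + (1 - Phi n)) * ρ univ) atTop
        (𝓝 0) := by
      have h := ENNReal.Tendsto.mul_const (ENNReal.tendsto_ofReal he)
        (Or.inr (measure_ne_top ρ univ))
      simpa using h
    simpa using h3.add ENNReal.tendsto_inv_nat_nhds_zero

end MetricFlow

end Literature.Geometry.Riemannian

end
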